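import Mathlib
import Literature.Analysis.FluidPDE.TaoAveragedSobolev
import Summits.NavierStokesRegularity.NavierStokesRegularity.Theses.PerpetualPump

/-!
# Sketch — crux-ideate stmt-NavierStokesRegularity-1832 (`PerpetualPump.Thesis`), ideator 1, round 1

First-lemma signatures for the idea card `bmo-endpoint-epsilon-ladder` (they need not be proved;
they must elaborate).  All statements are over existing declarations
(`Literature.Analysis.FluidPDE.Tao2016.*`, the route file) — `BMO` itself is not in Mathlib, so the
BMO-endpoint toolkit appears only in the docstrings; the typed statements are its CONSEQUENCES at
the `L^∞` tier of the crux.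

* `SerrinEndpointExtension`  — S0: the `L²_t L^∞_x` Prodi–Serrin endpoint is abstract over Tao's
  class (consequence of the `L²_t BMO_x` criterion; Kozono–Taniuchi bilinear BMO estimates +
  Hörmander–Mikhlin `L^∞ → BMO`).
* `EpsTypeIExtension`        — K1: per-datum ε-regularity at the Type-I tier (the crux with the
  constant `M` frozen below a threshold `ε(𝒜) > 0`): the abstract Leray lower bound on the
  Type-I constant.  Homogeneous of degree `-1` under the cone action `rscale` of
  `Cruxes/AveragedTypeIBlowup/Disproof.lean §8`, hence consistent with
  `averagedTypeIBlowup_iff_withRate`.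
* `TypeIPolynomialBound`     — S2: Type-I(M) ⇒ polynomial-in-`(T-t)⁻¹` a-priori bound of the
  `H¹⁰` norm (Gronwall at the BMO endpoint), the compactness currency of K2.
* `IntrinsicTypeI`, `IntrinsicEpsExtension` (K1′), `NoLogPileUp` (K1″), `epsTypeI_of_intrinsic`
  — the intrinsic-amplitude tier: ε-regularity holds there abstractly (K1′); the crux's `L^∞`
  tier is reached through the open no-log-pile-up stub (K1″); K1′ ∧ K1″ ⇒ K1 proved here.
* `epsTypeI_of_thesis`       — sanity: K1 is (trivially) implied by the crux (it is a special
  case), so it is weaker than the crux and not a restatement.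
-/

noncomputable section

set_option linter.dupNamespace false

namespace Summit.NavierStokesRegularity.NavierStokesRegularity.Cruxes.Thesis.SketchIdeator1

open MeasureTheory Set Filter Topology
open scoped ENNReal
open Literature.Analysis.FluidPDE Literature.Analysis.FluidPDE.Tao2016
open Summit.NavierStokesRegularity.NavierStokesRegularity.Theses.PerpetualPump

local notation "ℝ³" => EuclideanSpace ℝ (Fin 3)

/-- The extension clause of the crux, named: `u` (mild on `[0,T)` from `u₀`) continues as a mild
solution of the same averaged equation past `T`. -/
def ExtendsPast (𝒜 : AveragingDatum) (u₀ : SchwartzMap ℝ³ ℝ³) (T : ℝ) (u : ℝ → L2C) : Prop :=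
  ∃ T' : ℝ, T < T' ∧ ∃ v : ℝ → L2C,
    𝒜.IsMildSolution (schwartzL2 u₀) (Ico 0 T') v ∧ ∀ t ∈ Ico 0 T, v t = u t

/-- **S0 — the `L²_t L^∞_x` Serrin endpoint is abstract.** For every symmetric averaging datum with
cancellation, an `H¹⁰_df`-mild solution on `[0,T)` with `∫₀ᵀ ‖u(t)‖²_∞ dt < ∞` extends past `T`.
(Printed for NS: Kozono–Taniuchi 2000 via `L²_t BMO_x`; abstract because order-0 multipliers map
`L^∞ → BMO` and `BMO → BMO`, and the bilinear estimate
`‖fg‖_{Ḣˢ} ≲ ‖f‖_{Ḣˢ}‖g‖_{BMO} + ‖f‖_{BMO}‖g‖_{Ḣˢ}` closes the `Ḣˢ` energy inequality without the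
NS top-order cancellation.) -/
def SerrinEndpointExtension : Prop :=
  ∀ 𝒜 : AveragingDatum, 𝒜.IsSymmetric → 𝒜.HasCancellation →
    ∀ u₀ : SchwartzMap ℝ³ ℝ³, VectorCalculus.IsDivFree ⇑u₀ → ∀ T : ℝ, 0 < T → ∀ u : ℝ → L2C,
      𝒜.IsMildSolution (schwartzL2 u₀) (Ico 0 T) u →
      (∃ K : ℝ, ∀ t ∈ Ico 0 T, ∫ s in (0 : ℝ)..t, (eLpNorm (u s) ⊤ volume).toReal ^ 2 ≤ K) →
      ExtendsPast 𝒜 u₀ T u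

/-- **K1 — per-datum ε-regularity at the Type-I tier (abstract Leray lower bound on the Type-I
constant).** For every symmetric averaging datum `𝒜` with cancellation there is `ε = ε(𝒜) > 0`
such that every `H¹⁰_df`-mild solution from Schwartz divergence-free data obeying
`‖u(t)‖_∞ ≤ ε (T-t)^{-1/2}` on `[0,T)` extends past `T`.  (Gronwall at the BMO endpoint gives
`‖u(t)‖_{H¹⁰} ≲ (T-t)^{-C(𝒜)ε²}`; the abstract `H¹⁰` local theory gives `‖u(t)‖_{H¹⁰} ≳ (T-t)^{-1/2}`
before a non-continuable time; squeeze for `C(𝒜)ε² < 1/2`.) -/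
def EpsTypeIExtension : Prop :=
  ∀ 𝒜 : AveragingDatum, 𝒜.IsSymmetric → 𝒜.HasCancellation → ∃ ε : ℝ, 0 < ε ∧
    ∀ u₀ : SchwartzMap ℝ³ ℝ³, VectorCalculus.IsDivFree ⇑u₀ → ∀ T : ℝ, 0 < T → ∀ u : ℝ → L2C,
      𝒜.IsMildSolution (schwartzL2 u₀) (Ico 0 T) u →
      (∀ t ∈ Ico 0 T, eLpNorm (u t) ⊤ volume ≤ ENNReal.ofReal (ε / Real.sqrt (T - t))) →
      ExtendsPast 𝒜 u₀ T u

/-- **K1, limsup form.** Only the germ at `T` matters: the Type-I bound with the small constant is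
asked on a final interval `[T₁, T)` only. Equivalent content: if `u` does NOT extend past `T` then
`limsup_{t ↑ T} √(T-t) ‖u(t)‖_∞ ≥ ε(𝒜)` — Leray's 1934 lower bound, abstractly and per datum. -/
def EpsTypeIExtensionGerm : Prop :=
  ∀ 𝒜 : AveragingDatum, 𝒜.IsSymmetric → 𝒜.HasCancellation → ∃ ε : ℝ, 0 < ε ∧
    ∀ u₀ : SchwartzMap ℝ³ ℝ³, VectorCalculus.IsDivFree ⇑u₀ → ∀ T : ℝ, 0 < T → ∀ u : ℝ → L2C,
      𝒜.IsMildSolution (schwartzL2 u₀) (Ico 0 T) u →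
      (∃ T₁ ∈ Ico 0 T, ∀ t ∈ Ico T₁ T,
        eLpNorm (u t) ⊤ volume ≤ ENNReal.ofReal (ε / Real.sqrt (T - t))) →
      ExtendsPast 𝒜 u₀ T u

/-- **S2 — polynomial a-priori bound at the Type-I tier.** Type-I with constant `M` forces at most
polynomial growth of the `H¹⁰` norm: `‖u(t)‖_{H¹⁰} ≤ C (T-t)^{-p}` with `C, p` depending on
`𝒜, M, u₀, T` (Gronwall at the BMO endpoint; the compactness currency of the extraction step K2). -/
def TypeIPolynomialBound : Prop :=
  ∀ 𝒜 : AveragingDatum, 𝒜.IsSymmetric → 𝒜.HasCancellation →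
    ∀ u₀ : SchwartzMap ℝ³ ℝ³, VectorCalculus.IsDivFree ⇑u₀ → ∀ T : ℝ, 0 < T → ∀ u : ℝ → L2C,
      𝒜.IsMildSolution (schwartzL2 u₀) (Ico 0 T) u → ∀ M : ℝ,
      (∀ t ∈ Ico 0 T, eLpNorm (u t) ⊤ volume ≤ ENNReal.ofReal (M / Real.sqrt (T - t))) →
      ∃ C p : ℝ, ∀ t ∈ Ico 0 T,
        Literature.Analysis.FunctionSpaces.eFourierSobolevNorm 10 (u t) ≤ ENNReal.ofReal (C / (T - t) ^ p)

/-- The **symbol weight** of slot `i` at the sample `θ`: `1 + Σ_{k ≤ 6} ‖m_{i,θ}‖_k` (Tao's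
seminorms (1.10); six derivatives are more than the Hörmander–Mikhlin / kernel-`L¹` bounds in `ℝ³`
need).  Measures the size of the order-`0` multiplier; the intrinsic amplitude below is taken
RELATIVE to it (the multiplier is unbounded on `L^∞`, so `‖A_i(θ)u‖_∞` is not controlled by
`‖u‖_∞`, but each Littlewood–Paley piece is, with this weight). -/
def symbolWeight (𝒜 : AveragingDatum) (i : Fin 3) (θ : 𝒜.Ω) : ℝ :=
  1 + ∑ k ∈ Finset.range 7, (symbolSeminorm k (𝒜.m i θ)).toReal

/-- **Intrinsic Type-I bound** (the amplitude the averaged equation actually feels): every slot image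
`A_i(θ) u(t) = m_{i,θ}(D) Rot_{R_{i,θ}} Dil_{λ_{i,θ}} u(t)` obeys the Type-I rate with constant
`M · symbolWeight`.  For the Euler datum (`A_i = id`) this is the crux's `L^∞` hypothesis with
constant `2M`; in general it is STRONGER than the crux's hypothesis by exactly the `L^∞ → BMO` log of
Tao's p. 7 footnote. -/
def IntrinsicTypeI (𝒜 : AveragingDatum) (M T : ℝ) (u : ℝ → L2C) : Prop :=
  ∀ (i : Fin 3) (θ : 𝒜.Ω), ∀ t ∈ Ico 0 T,
    eLpNorm (𝒜.slot i θ (u t)) ⊤ volume ≤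
      ENNReal.ofReal (M * symbolWeight 𝒜 i θ / Real.sqrt (T - t))

/-- **K1′ — intrinsic ε-regularity (claimed TRUE, abstract).** For every symmetric averaging datum
with cancellation there is `ε(𝒜) > 0` such that an `H¹⁰_df`-mild solution from Schwartz
divergence-free data whose INTRINSIC amplitude is Type-I with constant `≤ ε` on `[0,T)` extends past
`T`.  Proof sketch: the `Ḣˢ` energy inequality for `∂ₜu = Δu + B̃(u,u)` has exactly one term that
is not controlled by `‖u‖_{Ḃ⁰_{∞,∞}}` (geometric low-frequency sums): the dilation-mismatch top-order
term `E_θ[((λ₂/λ₃)^s − 1) ∫ (A₁u_lo·∇)ΛˢA₂u_hi · ΛˢA₃u_hi]`, which the cyclic identity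
(symmetry + (1.16)) kills only when `λ₂ = λ₃`; it is bounded by the intrinsic amplitude; Gronwall
gives `‖u(t)‖_{Ḣˢ} ≲ (T−t)^{−C(𝒜)ε²}`, the abstract `H¹⁰` local theory gives `≳ (T−t)^{−1/2}` before
a non-continuable time; squeeze. -/
def IntrinsicEpsExtension : Prop :=
  ∀ 𝒜 : AveragingDatum, 𝒜.IsSymmetric → 𝒜.HasCancellation → ∃ ε : ℝ, 0 < ε ∧
    ∀ u₀ : SchwartzMap ℝ³ ℝ³, VectorCalculus.IsDivFree ⇑u₀ → ∀ T : ℝ, 0 < T → ∀ u : ℝ → L2C,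
      𝒜.IsMildSolution (schwartzL2 u₀) (Ico 0 T) u → IntrinsicTypeI 𝒜 ε T u →
      ExtendsPast 𝒜 u₀ T u

/-- **K1″ — no log pile-up (OPEN; the card's new stub).** For a mild solution of a symmetric
cancelling averaged equation, the crux's `L^∞` Type-I bound with constant `M` implies the intrinsic
Type-I bound with constant `C(𝒜) · M` (no `log(1/(T−t))` accumulation of `L^∞`-saturated
intermediate scales).  TRUE for the Euler datum (trivially) and for every wavelet/DSS pump profile
(geometric critical trail); abstractly its failure mode is a Type-I-fed lacunary tower of
`L^∞`-saturated supercritical coarse eddies. Together with K1′ it gives K1 (`EpsTypeIExtension`). -/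
def NoLogPileUp : Prop :=
  ∀ 𝒜 : AveragingDatum, 𝒜.IsSymmetric → 𝒜.HasCancellation → ∃ C : ℝ, 0 < C ∧
    ∀ u₀ : SchwartzMap ℝ³ ℝ³, VectorCalculus.IsDivFree ⇑u₀ → ∀ T : ℝ, 0 < T → ∀ u : ℝ → L2C,
      𝒜.IsMildSolution (schwartzL2 u₀) (Ico 0 T) u → ∀ M : ℝ, 0 ≤ M →
      (∀ t ∈ Ico 0 T, eLpNorm (u t) ⊤ volume ≤ ENNReal.ofReal (M / Real.sqrt (T - t))) →
      IntrinsicTypeI 𝒜 (C * M) T u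

/-- K1′ ∧ K1″ ⇒ K1 (pure logic: take `ε₁ = ε/C`; a negative `M` forces `u = 0` a.e., handled by
monotonicity in `M` — here we simply restrict to the `ε/C` constant, which is nonnegative). -/
theorem epsTypeI_of_intrinsic (h₁ : IntrinsicEpsExtension) (h₂ : NoLogPileUp) :
    EpsTypeIExtension := by
  intro 𝒜 hs hc
  obtain ⟨ε, hε, hmain⟩ := h₁ 𝒜 hs hc
  obtain ⟨C, hC, hpile⟩ := h₂ 𝒜 hs hc
  refine ⟨ε / C, div_pos hε hC, ?_⟩
  intro u₀ hdiv T hT u hmild hrate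
  have key : IntrinsicTypeI 𝒜 (C * (ε / C)) T u :=
    hpile u₀ hdiv T hT u hmild (ε / C) (div_pos hε hC).le hrate
  have hCε : C * (ε / C) = ε := by field_simp
  rw [hCε] at key
  exact hmain u₀ hdiv T hT u hmild key

/-- Sanity: K1 is a special case of the crux (take any `ε`, e.g. `1`), hence strictly on the
"weaker than the crux" side — it is a lemma of a line, not a costume of the target. -/
theorem epsTypeI_of_thesis (h : Thesis) : EpsTypeIExtension := by
  intro 𝒜 hs hc
  refine ⟨1, one_pos, ?_⟩
  intro u₀ hdiv T hT u hmild hrate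
  exact h 𝒜 hs hc u₀ hdiv T hT u hmild ⟨1, hrate⟩

/-- Sanity: the germ form implies the plain form (take `T₁ = 0`). -/
theorem epsTypeI_of_germ (h : EpsTypeIExtensionGerm) : EpsTypeIExtension := by
  intro 𝒜 hs hc
  obtain ⟨ε, hε, hmain⟩ := h 𝒜 hs hc
  refine ⟨ε, hε, ?_⟩
  intro u₀ hdiv T hT u hmild hrate
  exact hmain u₀ hdiv T hT u hmild ⟨0, ⟨le_rfl, hT⟩, fun t ht => hrate t ht⟩

end Summit.NavierStokesRegularity.NavierStokesRegularity.Cruxes.Thesis.SketchIdeator1
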